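import Mathlib
import Summits.ValiantsHypothesis.ValiantsHypothesis.Theses.FeketeSOS
import Summits.ValiantsHypothesis.ValiantsHypothesis.Theorems.FeketeSOSFeketeNoSparseSplitFeketeModPOrder

/-!
# Sketch — crux idea `depth-spectrum-gap` for `FeketeSOS.FeketeSOSHard` (stmt-ValiantsHypothesis-3996)

Round-2 crux-ideate (ideator 5).  First-lemma signatures only (no proofs required at this stage);
everything here is a `Prop` over existing declarations and must elaborate.

* `DepthGapBoundedHeight` — FIRST LEMMA (provable now, size M/L): the product formula in `ℚ(ζ_p)`
  applied to the cyclotomic values of an INTEGER lift of bounded height forces a two-sided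
  order–sparsity law: a configuration `∑ A_j B_j` that is cheap (`H² · ∑ √(t_{A_j} t_{B_j})` small)
  and deep at `X = 1` modulo `p` is an EXACT multiple of `Φ_p = 1 + X + ⋯ + X^{p-1}` modulo
  `X^p - 1`, hence has depth `p - 1` (the socle).  Socle tilings are exactly this exceptional branch.
* `DepthSpectrumGap` / `DepthSpectrumGapPoly` — the TRANSFER TARGET (two-sided OS): the exact
  `(X-1)`-adic depth of a cheap sum of sparse products in `K[X]/(X^p-1)`, `char K = p`, lies within
  `C·T` (resp. `C (r+1)^C T`) of an END of `[0, p-1]`.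
* `Transfer` — `DepthSpectrumGapPoly → CharPSparseSOS` (pure bookkeeping, provable: `F̄_p` has exact
  depth `(p-1)/2`, the middle of the forbidden window).
-/

namespace Summit.ValiantsHypothesis.ValiantsHypothesis.Cruxes.FeketeSOSHard.DepthSpectrumGap

open Polynomial Finset
open scoped BigOperators

noncomputable section

/-- Support-sum `T = ∑_j (|supp A_j| + |supp B_j|)` of a product family. [folklore] -/
def pairSupport {R : Type*} [Semiring R] {r : ℕ} (A B : Fin r → R[X]) : ℕ :=
  ∑ j, ((A j).support.card + (B j).support.card)

/-- `T' = ∑_j √(|supp A_j| · |supp B_j|) ≤ T/2` — the quantity the Parseval/Cauchy–Schwarz step sees. -/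
def sqrtSupport {R : Type*} [Semiring R] {r : ℕ} (A B : Fin r → R[X]) : ℝ :=
  ∑ j, Real.sqrt (((A j).support.card : ℝ) * ((B j).support.card : ℝ))

/-- `Φ_p`-as-used-here: the all-ones polynomial `1 + X + ⋯ + X^{p-1}` (`= (X-1)^{p-1}` mod `p`). -/
def allOnes (R : Type*) [Semiring R] (p : ℕ) : R[X] := ∑ i ∈ range p, X ^ i

/-- The cyclic reduction of an integer configuration, read modulo `p`. -/
def cyclicModP (p : ℕ) (E : ℤ[X]) : (ZMod p)[X] :=
  (E %ₘ (X ^ p - 1)).map (Int.castRingHom (ZMod p))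

/-- **First lemma (provable now): bounded-height depth gap = cyclotomic exactness.**
For `A_j, B_j ∈ ℤ[X]` of degree `< p` with coefficients in `[-H, H]`, let `Ē` be the reduction
mod `p` of `∑ A_j B_j mod (X^p - 1)`.  If `Ē ≠ 0`, `(X-1)^M ∣ Ē`, and
`(H² · T' · p/(p-1))^{p-1} < p^M` with `T' = ∑_j √(t_{A_j} t_{B_j})`, then
`∑ A_j B_j ≡ c · (1 + X + ⋯ + X^{p-1}) (mod X^p - 1)` over `ℤ` — whence `Ē = c̄ (X-1)^{p-1}`,
depth exactly `p - 1`.  Proof: `ν_u := Ẽ(ζ_p^u)` (`u = 1..p-1`) are the conjugates of an element of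
`ℤ[ζ_p]` divisible by `(ζ_p-1)^M` (any lift of a depth-`M` class is), so `p^M ∣ N(ν_1)`; but
`|N(ν_1)| ≤ (mean_u |ν_u|)^{p-1} ≤ (p/(p-1) · H² T')^{p-1}` by Parseval and Cauchy–Schwarz on `μ_p`;
so `ν_1 = 0`, i.e. `Φ_p ∣ Ẽ`. [new — conjectural until proved in Theorems] -/
def DepthGapBoundedHeight : Prop :=
  ∀ (p : ℕ) [Fact p.Prime] (r H : ℕ) (A B : Fin r → ℤ[X]) (M : ℕ),
    (∀ j, (A j).natDegree < p ∧ (B j).natDegree < p) →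
    (∀ j n, |(A j).coeff n| ≤ H ∧ |(B j).coeff n| ≤ H) →
    cyclicModP p (∑ j, A j * B j) ≠ 0 →
    (X - 1 : (ZMod p)[X]) ^ M ∣ cyclicModP p (∑ j, A j * B j) →
    ((H : ℝ) ^ 2 * sqrtSupport A B * ((p : ℝ) / ((p : ℝ) - 1))) ^ (p - 1) < (p : ℝ) ^ M →
    ∃ c : ℤ, (X ^ p - 1 : ℤ[X]) ∣ (∑ j, A j * B j) - C c * allOnes ℤ p

/-- Corollary shape (the "gap"): under the same hypotheses the class is the socle. -/
def DepthGapBoundedHeightSocle : Prop :=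
  ∀ (p : ℕ) [Fact p.Prime] (r H : ℕ) (A B : Fin r → ℤ[X]) (M : ℕ),
    (∀ j, (A j).natDegree < p ∧ (B j).natDegree < p) →
    (∀ j n, |(A j).coeff n| ≤ H ∧ |(B j).coeff n| ≤ H) →
    cyclicModP p (∑ j, A j * B j) ≠ 0 →
    (X - 1 : (ZMod p)[X]) ^ M ∣ cyclicModP p (∑ j, A j * B j) →
    ((H : ℝ) ^ 2 * sqrtSupport A B * ((p : ℝ) / ((p : ℝ) - 1))) ^ (p - 1) < (p : ℝ) ^ M →
    (X - 1 : (ZMod p)[X]) ^ (p - 1) ∣ cyclicModP p (∑ j, A j * B j)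

/-- **Transfer target, bold form (two-sided order–sparsity; `C = 1` fits all data).**
In `K[X]`, `char K = p`: if `∑_{j<r} A_j B_j` (degrees `< p`) is nonzero mod `X^p - 1` and has
EXACT `(X-1)`-order `M`, then `M ≤ C·T` or `M ≥ p - 1 - C·T`, `T = ∑ (|A_j| + |B_j|)`.
The dead line's `OrdSparsitySum` was the one-sided half of this; the socle tiling and the
θ-ladder (order `p-1-j` at cost `≈ 3(j+1)√p`) live in the upper window. [new conjecture] -/
def DepthSpectrumGapWith (C : ℕ) : Prop :=
  ∀ (K : Type) [Field K] (p : ℕ) [Fact p.Prime] [CharP K p] (r : ℕ) (A B : Fin r → K[X]) (M : ℕ),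
    (∀ j, (A j).natDegree < p ∧ (B j).natDegree < p) →
    ¬ ((X : K[X]) ^ p - 1 ∣ ∑ j, A j * B j) →
    (X - 1 : K[X]) ^ M ∣ ∑ j, A j * B j →
    ¬ ((X - 1 : K[X]) ^ (M + 1) ∣ ∑ j, A j * B j) →
    M ≤ C * pairSupport A B ∨ p ≤ M + 1 + C * pairSupport A B

def DepthSpectrumGap : Prop := ∃ C : ℕ, DepthSpectrumGapWith C

/-- Transfer target, safe form (polynomial loss in the number of products). -/
def DepthSpectrumGapPolyWith (C : ℕ) : Prop :=
  ∀ (K : Type) [Field K] (p : ℕ) [Fact p.Prime] [CharP K p] (r : ℕ) (A B : Fin r → K[X]) (M : ℕ),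
    (∀ j, (A j).natDegree < p ∧ (B j).natDegree < p) →
    ¬ ((X : K[X]) ^ p - 1 ∣ ∑ j, A j * B j) →
    (X - 1 : K[X]) ^ M ∣ ∑ j, A j * B j →
    ¬ ((X - 1 : K[X]) ^ (M + 1) ∣ ∑ j, A j * B j) →
    M ≤ C * (r + 1) ^ C * pairSupport A B ∨ p ≤ M + 1 + C * (r + 1) ^ C * pairSupport A B

def DepthSpectrumGapPoly : Prop := ∃ C : ℕ, DepthSpectrumGapPolyWith C

/-- The bold form implies the safe form (trivial). -/
theorem depthSpectrumGapPoly_of_gap : DepthSpectrumGap → DepthSpectrumGapPoly := by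
  rintro ⟨C, hC⟩
  refine ⟨C, ?_⟩
  intro K _ p _ _ r A B M hdeg hnd hdvd hndvd
  rcases hC K p r A B M hdeg hnd hdvd hndvd with h | h
  · left
    calc M ≤ C * pairSupport A B := h
      _ = C * 1 * pairSupport A B := by ring
      _ ≤ C * (r + 1) ^ C * pairSupport A B := by
          apply Nat.mul_le_mul_right
          apply Nat.mul_le_mul_left
          exact Nat.one_le_pow _ _ (Nat.succ_pos r)
  · right
    calc p ≤ M + 1 + C * pairSupport A B := h
      _ = M + 1 + C * 1 * pairSupport A B := by ring
      _ ≤ M + 1 + C * (r + 1) ^ C * pairSupport A B := by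
          apply Nat.add_le_add_left
          apply Nat.mul_le_mul_right
          apply Nat.mul_le_mul_left
          exact Nat.one_le_pow _ _ (Nat.succ_pos r)

/-- **The transfer** to the route's char-`p` crux (★) `CharPSparseSOS` (stmt-14989), child of
`FeketeSOSHard`: a cyclic representation `∑ c_i g_i² ≡ F̄_p` is the product family
`A_i = C(c_i)·g_i`, `B_i = g_i` (`T ≤ 2 ∑ |supp g_i|`), nonzero mod `X^p - 1`, of exact order
`N = (p-1)/2` at `X = 1` (landed `stub_feketeModPOrder`); both branches of the gap give
`C (s+1)^C · 2∑|supp g_i| ≥ N`, i.e. `∑|supp g_i| ≥ p^{1-Cδ}/(4C·2^C) ≥ p^{1/2+δ}` for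
`δ ≤ 1/(2(C+1))` and `p ≥ p₀(C, δ)`. Pure bookkeeping. -/
def Transfer : Prop :=
  DepthSpectrumGapPoly → Summit.ValiantsHypothesis.ValiantsHypothesis.Theses.FeketeSOS.CharPSparseSOS


/-! ### The transfer, ℕ-core (PROVED): the bold gap ⟹ the LINEAR form of (★)
`(p-1)/2 ≤ C · 2∑|supp g_i|` for every cyclic char-`p` representation `∑ c_i g_i² ≡ F̄_p`. -/

section TransferCore

open Literature.NumberTheory.LFunctions
open Summit.ValiantsHypothesis.ValiantsHypothesis.Theorems.FeketeNoSparseSplitCyclic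
  (stub_feketeModPOrder fmo_map_feketePolynomial_ne_zero fmo_coeff_iterate_XD fmo_intCast_legendreSym)

variable {K : Type} [Field K]

/-- `j` applications of `X·d/dX` cost at most `j` factors of `X - 1`. [folklore] -/
theorem iterate_XD_dvd (G : K[X]) (k : ℕ) (h : (X - C 1) ^ k ∣ G) (j : ℕ) :
    (X - C 1) ^ (k - j) ∣ (fun g : K[X] => X * derivative g)^[j] G := by
  induction j with
  | zero => rwa [Nat.sub_zero, Function.iterate_zero_apply]
  | succ j ih =>
    rw [Function.iterate_succ_apply', Nat.sub_add_eq]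
    exact dvd_mul_of_dvd_right (pow_sub_one_dvd_derivative_of_pow_dvd ih) X

/-- Coefficients of the inlined `F̄_p`. -/
theorem coeff_fbar (p : ℕ) [Fact p.Prime] (n : ℕ) :
    (∑ m ∈ range p, C ((legendreSym p m : ℤ) : K) * X ^ m).coeff n
      = if n < p then ((legendreSym p n : ℤ) : K) else 0 := by
  simp only [finset_sum_coeff, coeff_C_mul_X_pow]
  rw [Finset.sum_ite_eq (range p) n]
  simp only [Finset.mem_range]

/-- `(X·d/dX)^j F̄_p = Σ_{m<p} (m|p)·m^j X^m`. -/
theorem iterate_XD_fbar (p : ℕ) [Fact p.Prime] (j : ℕ) :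
    (fun g : K[X] => X * derivative g)^[j] (∑ m ∈ range p, C ((legendreSym p m : ℤ) : K) * X ^ m)
      = ∑ m ∈ range p, C (((legendreSym p m : ℤ) : K) * (m : K) ^ j) * X ^ m := by
  ext n
  rw [fmo_coeff_iterate_XD, coeff_fbar]
  simp only [finset_sum_coeff, coeff_C_mul_X_pow]
  rw [Finset.sum_ite_eq (range p) n]
  simp only [Finset.mem_range]
  split_ifs <;> simp

/-- **Upper half of the exact order**: `(X-1)^{(p-1)/2+1} ∤ F̄_p` (moments: `Σ_m (m|p) m^{(p-1)/2} = Σ_{m≠0} m^{p-1} = -1 ≠ 0`). -/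
theorem not_pow_succ_half_dvd_fbar (p : ℕ) [Fact p.Prime] [CharP K p] (hp : p ≠ 2) :
    ¬ (X - C 1 : K[X]) ^ ((p - 1) / 2 + 1) ∣ ∑ m ∈ range p, C ((legendreSym p m : ℤ) : K) * X ^ m := by
  intro h
  have hprime : p.Prime := Fact.out
  have hp2 : 2 ≤ p := hprime.two_le
  have hodd : p % 2 = 1 := by
    rcases Nat.even_or_odd p with he | ho
    · exfalso
      obtain ⟨k, hk⟩ := he
      have := hprime.eq_one_or_self_of_dvd 2 ⟨k, by omega⟩
      omega
    · exact Nat.odd_iff.mp ho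
  set N := (p - 1) / 2 with hN
  have hdiv : (X - C 1 : K[X]) ^ (N + 1 - N) ∣ (fun g : K[X] => X * derivative g)^[N]
      (∑ m ∈ range p, C ((legendreSym p m : ℤ) : K) * X ^ m) := iterate_XD_dvd _ _ h N
  rw [show N + 1 - N = 1 by omega, pow_one, iterate_XD_fbar, dvd_iff_isRoot, IsRoot.def,
    eval_finset_sum] at hdiv
  simp only [eval_mul, eval_C, eval_pow, eval_X, one_pow, mul_one] at hdiv
  -- the sum is Σ_{m<p} (m:K)^{p-1} = p - 1 = -1
  have hterm : ∀ m ∈ range p, ((legendreSym p m : ℤ) : K) * (m : K) ^ N = if m = 0 then 0 else 1 := by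
    intro m hm
    rw [Finset.mem_range] at hm
    rw [fmo_intCast_legendreSym, ← pow_add, show p / 2 + N = p - 1 by omega]
    split_ifs with h0
    · rw [h0, Nat.cast_zero, zero_pow (by omega)]
    · have hm' : ((m : ZMod p)) ≠ 0 := by
        rw [Ne, ZMod.natCast_eq_zero_iff]
        exact Nat.not_dvd_of_pos_of_lt (Nat.pos_of_ne_zero h0) hm
      have h1 : ((m : ZMod p)) ^ (p - 1) = 1 := ZMod.pow_card_sub_one_eq_one hm'
      have h2 := congrArg (ZMod.castHom (dvd_refl p) K) h1
      rwa [map_pow, map_natCast, map_one] at h2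
  rw [Finset.sum_congr rfl hterm, Finset.sum_ite, Finset.sum_const_zero, zero_add,
    Finset.sum_const, nsmul_eq_mul, mul_one] at hdiv
  have hcard : ((range p).filter (fun m => ¬ m = 0)).card = p - 1 := by
    rw [Finset.filter_ne', Finset.card_erase_of_mem (Finset.mem_range.mpr hprime.pos),
      Finset.card_range]
  rw [hcard, Nat.cast_sub hprime.one_le, CharP.cast_eq_zero K p, Nat.cast_one, zero_sub,
    neg_eq_zero] at hdiv
  exact one_ne_zero hdiv

theorem card_support_C_mul_le (a : K) (g : K[X]) : (C a * g).support.card ≤ g.support.card := by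
  rw [C_mul']
  exact Finset.card_le_card (support_smul a g)

theorem map_fekete_eq_sum (p : ℕ) [Fact p.Prime] :
    (feketePolynomial p).map (Int.castRingHom K)
      = ∑ m ∈ range p, C ((legendreSym p m : ℤ) : K) * X ^ m := by
  rw [map_feketePolynomial]
  rfl

/-- **(★)-linear from the bold gap** — the ℕ-core of `Transfer`. -/
theorem linearStar_of_gap {C0 : ℕ} (hgap : DepthSpectrumGapWith C0)
    (p : ℕ) [Fact p.Prime] [CharP K p] (hp : p ≠ 2)
    (s : ℕ) (c : Fin s → K) (g : Fin s → K[X]) (hdeg : ∀ i, (g i).natDegree < p)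
    (hrep : (X : K[X]) ^ p - 1 ∣
      (∑ i, C (c i) * g i ^ 2) - ∑ m ∈ range p, C ((legendreSym p m : ℤ) : K) * X ^ m) :
    (p - 1) / 2 ≤ C0 * (2 * ∑ i, (g i).support.card) := by
  have hprime : p.Prime := Fact.out
  have hp2 : 2 ≤ p := hprime.two_le
  set F : K[X] := ∑ m ∈ range p, C ((legendreSym p m : ℤ) : K) * X ^ m with hF
  set N : ℕ := (p - 1) / 2 with hN
  have hFmap : (feketePolynomial p).map (Int.castRingHom K) = F := map_fekete_eq_sum p
  have hF0 : F ≠ 0 := by rw [← hFmap]; exact fmo_map_feketePolynomial_ne_zero p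
  -- exact order N of F̄_p at 1
  have hlow : (X - C 1 : K[X]) ^ N ∣ F := by
    have h := stub_feketeModPOrder K p hp
    rw [hFmap] at h
    exact (le_rootMultiplicity_iff hF0).mp h
  have hup : ¬ (X - C 1 : K[X]) ^ (N + 1) ∣ F := not_pow_succ_half_dvd_fbar p hp
  -- the product family
  obtain ⟨W, hW⟩ := hrep
  set A : Fin s → K[X] := fun i => C (c i) * g i with hA
  set B : Fin s → K[X] := g with hB
  have hE : (∑ j, A j * B j) = ∑ i, C (c i) * g i ^ 2 :=
    Finset.sum_congr rfl fun i _ => by simp only [hA, hB]; ring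
  have hEF : (∑ j, A j * B j) = F + (X ^ p - 1) * W := by
    rw [hE]; linear_combination hW
  have hfrob : (X : K[X]) ^ p - 1 = (X - C 1) ^ p := by
    rw [sub_pow_char, ← C_pow, one_pow, C_1]
  have hdegAB : ∀ j, (A j).natDegree < p ∧ (B j).natDegree < p := fun j =>
    ⟨lt_of_le_of_lt (natDegree_C_mul_le (c j) (g j)) (hdeg j), hdeg j⟩
  -- nonzero modulo X^p - 1
  have hdegF : F.natDegree < p := by
    rw [← hFmap]
    refine lt_of_le_of_lt (natDegree_map_le) ?_
    rw [natDegree_feketePolynomial]; omega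
  have hnd : ¬ ((X : K[X]) ^ p - 1 ∣ ∑ j, A j * B j) := by
    rintro ⟨V, hV⟩
    have hFdvd : (X : K[X]) ^ p - 1 ∣ F :=
      ⟨V - W, by rw [mul_sub, ← hV, hEF]; ring⟩
    have hle := natDegree_le_of_dvd hFdvd hF0
    have hdegXp : ((X : K[X]) ^ p - 1).natDegree = p := by
      rw [← C_1, natDegree_X_pow_sub_C]
    omega
  -- exact order N of the family
  have hdvdE : (X - C 1 : K[X]) ^ N ∣ ∑ j, A j * B j := by
    rw [hEF]
    refine dvd_add hlow (dvd_mul_of_dvd_left ?_ W)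
    rw [hfrob]; exact pow_dvd_pow _ (by omega)
  have hndvdE : ¬ (X - C 1 : K[X]) ^ (N + 1) ∣ ∑ j, A j * B j := by
    intro h
    apply hup
    have h2 : (X - C 1 : K[X]) ^ (N + 1) ∣ (X ^ p - 1) * W := by
      apply dvd_mul_of_dvd_left
      rw [hfrob]; exact pow_dvd_pow _ (by omega)
    have hFeq : F = (∑ j, A j * B j) - (X ^ p - 1) * W := by rw [hEF]; ring
    rw [hFeq]; exact dvd_sub h h2
  have hC1 : (X - C 1 : K[X]) = X - 1 := by rw [C_1]
  rw [hC1] at hdvdE hndvdE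
  -- apply the gap
  have hT : pairSupport A B ≤ 2 * ∑ i, (g i).support.card := by
    unfold pairSupport
    rw [two_mul, ← Finset.sum_add_distrib]
    exact Finset.sum_le_sum fun i _ => Nat.add_le_add_right (card_support_C_mul_le (c i) (g i)) _
  rcases hgap K p s A B N hdegAB hnd hdvdE hndvdE with h | h
  · calc (p - 1) / 2 = N := rfl
      _ ≤ C0 * pairSupport A B := h
      _ ≤ C0 * (2 * ∑ i, (g i).support.card) := Nat.mul_le_mul_left _ hT
  · have h' : N ≤ C0 * pairSupport A B := by omega
    calc (p - 1) / 2 = N := rfl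
      _ ≤ C0 * pairSupport A B := h'
      _ ≤ C0 * (2 * ∑ i, (g i).support.card) := Nat.mul_le_mul_left _ hT

end TransferCore

end

end Summit.ValiantsHypothesis.ValiantsHypothesis.Cruxes.FeketeSOSHard.DepthSpectrumGap
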